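import Mathlib
import Summits.QuantumFields.YangMills.Theorems.AdjointLoopFanoDirichletPrelim
import Summits.QuantumFields.YangMills.Theorems.LuscherReductionRunningReductionUniformFloor
import Summits.QuantumFields.YangMills.Theorems.TransportFieldFanoAdjointLoopDirichletWeakStubKinematicChain
import Summits.QuantumFields.YangMills.Theorems.FemtoCutoffLadderFixedLatticeLawOffTubeKernel
import HarnessLib

/-!
# The MAGNETIC ENERGY of the exact zero-flux vacuum is `O(1/β)` at every fixed lattice:
# `∫ S(U) Ω(U)² dU ≤ (−log c_L)/β` for `β ≥ 1` (route `TransportFieldFano`, crux ⟨stmt-QuantumFields-23362⟩ helper lane)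

LINE g17-A of planner ym-idea-4 (`AdjointLoopDirichletWeak`, stub `stub_dWeightedPlaquetteMean` / the shared open lemma
`weightedTemporalPlaquette_le` of the planner's memo): every estimate of that line treats the plaquette of the EXACT transfer-matrix ground
state `Ω` (`K_βΩ = λ₀Ω`, `Ω` physical) as an `O(1/β)` quantity.  The tree had this for the TEMPORAL plaquette in the vacuum pair measure with an
`O(|E| log β/β)` budget (✓`AdjointLoopFano.vacuum_mean_temporal_plaquette_le`).  This file proves the MAGNETIC half, with NO `log β`:

* §1 `wilsonAction_su2_le_four_card_lat`, `isPhys_wilsonAction_mul` — the spatial Wilson action `S` is a bounded gauge- and twist-invariant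
  multiplier (measurable: ✓`FemtoCutoffLadder.measurable_wilsonAction_su2Lat`), so `S·Ω` is physical;
* §2 `integral_pair_mul_fst_eq` / `_snd_eq` — in the vacuum pair measure `Ω(U)K_β(U,V)Ω(V) dU dV` a one-slice multiplier integrates to
  `λ₀ ∫ J Ω²` (eigen-equation + symmetry of the transfer form);
* §3 ★★ `vacuum_magnetic_energy_le_of_nonneg` — for `β ≥ 1`, `Ω ≥ 0` physical, `‖Ω‖ = 1`, `K_βΩ = λ₀Ω`:
  `∫ S Ω² ≤ (−log uniformFloorConst L)/β`.  PROOF: tangent-line Jensen (✓`integral_mul_le_mul_log`) on the pair measure (mass `λ₀`) with the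
  FULL magnetic tilt `X = (β/2)(S(U)+S(V))`: `e^X K_β = E_β` exactly (✓`transferKernel_eq_latE_mul`), whose `Ω`-sandwich is `≤ c_β^{|E|}` by
  AM–GM and the row sums of `E_β` (✓`integral_prod_latE_mul_fst/snd`); so `β λ₀ ∫SΩ² = ∫ X w ≤ λ₀ log(c_β^{|E|}/λ₀) ≤ λ₀ (−log c_L)` by the
  β-UNIFORM floor `c_L c_β^{|E|} ≤ λ₀` (✓`levelValue_zero_ge_uniform`).
* §4 ★★ `vacuum_magnetic_energy_le` — the same for EVERY `l2`-normalised physical eigenfunction at `λ₀` (no sign hypothesis), by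
  Perron–Frobenius–Jentzsch (✓`PhysL2.exists_groundState`, ✓`ae_eq_smul_groundState`); per-plaquette corollary `vacuum_plaquette_le`.

`−log uniformFloorConst L = 8|P| − |E| log winConst(1/(14L)) + log 8 + 8·offCount·log 5 = O(L³ log L)` is β-FREE, so the magnetic energy
per plaquette of the exact vacuum is `O(log L/β)` uniformly in `β ≥ 1`.  HONEST FRAMING: fixed-lattice helper estimates (`--supports 23362`);
no stub, crux, rung or summit statement is proved here; nothing about infinite volume, the continuum or the Yang–Mills mass gap.
No `sorry`, no new definition.  References: [cite: ReedSimonIV1978, Thm. XIII.1 and XIII.43]; [cite: Luscher1983, §2–3];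
[cite: SeilerLNP1982, §3].
-/

set_option autoImplicit false

noncomputable section

open MeasureTheory Filter Topology Real
open Literature.MathematicalPhysics.QuantumFieldTheory (GaugeConfig Site Edge Plaquette gaugeTransform wilsonAction
  wilsonAction_gaugeTransform plaquetteHolonomy)
open Literature.MathematicalPhysics.QuantumLattice (fundamentalRep_apply secondCountableTopology_su2)

namespace Summit.QuantumFields.YangMills.Theorems.TransportFieldFano

open Summit.QuantumFields.YangMills.Theorems.FemtoTransferGap
open Summit.QuantumFields.YangMills.Theorems.AdjointLoopFano

variable {L : ℕ} [NeZero L]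

/-! ## §1 The spatial Wilson action as a physical multiplier -/

/-- `S(U) ≤ 4|P|` for the `SU(2)` Wilson action of `(ℤ/L)³` (`Re tr U_p ≥ −2`). [folklore] -/
theorem wilsonAction_su2_le_four_card_lat (U : GaugeConfig 3 L SU2) :
    wilsonAction su2Rep U ≤ 4 * (Fintype.card (Plaquette 3 L) : ℝ) := by
  unfold wilsonAction
  have h : ∀ p ∈ (Finset.univ : Finset (Plaquette 3 L)),
      ((2 : ℕ) : ℝ) - ((su2Rep (plaquetteHolonomy U p.1 p.2.1.1 p.2.1.2)).trace).re ≤ 4 := by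
    intro p _
    have h := neg_two_le_re_trace (plaquetteHolonomy U p.1 p.2.1.1 p.2.1.2)
    rw [fundamentalRep_apply]
    push_cast
    linarith
  calc ∑ p : Plaquette 3 L, (((2 : ℕ) : ℝ) - ((su2Rep (plaquetteHolonomy U p.1 p.2.1.1 p.2.1.2)).trace).re)
      ≤ ∑ _p : Plaquette 3 L, (4 : ℝ) := Finset.sum_le_sum h
    _ = 4 * (Fintype.card (Plaquette 3 L) : ℝ) := by rw [Finset.sum_const, Finset.card_univ, nsmul_eq_mul, mul_comm]

/-- `|S(U)| ≤ 4|P|`. [folklore] -/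
theorem abs_wilsonAction_su2_le_lat (U : GaugeConfig 3 L SU2) :
    |wilsonAction su2Rep U| ≤ 4 * (Fintype.card (Plaquette 3 L) : ℝ) := by
  rw [abs_of_nonneg (wilsonAction_su2_nonneg_lat U)]
  exact wilsonAction_su2_le_four_card_lat U

/-- **`S·Ω` is physical** for a physical `Ω`: `S` is bounded, measurable, gauge invariant and invariant under the three central twists.
[cite: tHooft1979] -/
theorem isPhys_wilsonAction_mul {Ω : GaugeConfig 3 L SU2 → ℝ} (hΩ : IsPhys Ω) :
    IsPhys fun U => wilsonAction su2Rep U * Ω U :=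
  hΩ.mul_of_invariant FemtoCutoffLadder.measurable_wilsonAction_su2Lat abs_wilsonAction_su2_le_lat
    (fun g U => wilsonAction_gaugeTransform su2Rep g U)
    (fun k _ hz U => wilsonAction_twist_of_mem_center su2Rep k hz U)

/-! ## §2 One-slice multipliers in the vacuum pair measure -/

/-- **First-slice multiplier**: for physical `J`, `Ω` with `K_βΩ = λ₀Ω`,
`∫∫ Ω(U)K_β(U,V)Ω(V)·J(U) = λ₀ ∫ J Ω²` (the product integral is `⟨JΩ, K_βΩ⟩ = λ₀⟨JΩ, Ω⟩`). [cite: ReedSimonIV1978, Thm. XIII.1] -/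
theorem integral_pair_mul_fst_eq (β : ℝ) {J Ω : GaugeConfig 3 L SU2 → ℝ} (hJΩ : IsPhys fun U => J U * Ω U) (hΩ : IsPhys Ω)
    (heig : transferApply β Ω = topValue su2Rep L β • Ω) :
    ∫ p, Ω p.1 * transferKernel su2Rep β p.1 p.2 * Ω p.2 * J p.1 ∂(configMeasure SU2 L).prod (configMeasure SU2 L) =
      topValue su2Rep L β * ∫ U, J U * Ω U ^ 2 ∂configMeasure SU2 L := by
  haveI : SecondCountableTopology SU2 := secondCountableTopology_su2
  have h1 : ∫ p, Ω p.1 * transferKernel su2Rep β p.1 p.2 * Ω p.2 * J p.1 ∂(configMeasure SU2 L).prod (configMeasure SU2 L) =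
      ∫ p, (J p.1 * Ω p.1) * transferKernel su2Rep β p.1 p.2 * Ω p.2 ∂(configMeasure SU2 L).prod (configMeasure SU2 L) :=
    integral_congr_ae (ae_of_all _ fun p => by ring)
  rw [h1, ← qform_eq_integral_prod su2Rep continuous_su2Rep β hJΩ hΩ, qform_eq_l2_transferApply, heig, l2_comm, l2_smul_left,
    l2_comm]
  unfold l2
  congr 1
  exact integral_congr_ae (ae_of_all _ fun U => by ring)

/-- **Second-slice multiplier**: `∫∫ Ω(U)K_β(U,V)Ω(V)·J(V) = λ₀ ∫ J Ω²` (symmetry of the transfer form, ✓`qform_su2Rep_comm`).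
[cite: SeilerLNP1982, §3] -/
theorem integral_pair_mul_snd_eq (β : ℝ) {J Ω : GaugeConfig 3 L SU2 → ℝ} (hJΩ : IsPhys fun U => J U * Ω U) (hΩ : IsPhys Ω)
    (heig : transferApply β Ω = topValue su2Rep L β • Ω) :
    ∫ p, Ω p.1 * transferKernel su2Rep β p.1 p.2 * Ω p.2 * J p.2 ∂(configMeasure SU2 L).prod (configMeasure SU2 L) =
      topValue su2Rep L β * ∫ U, J U * Ω U ^ 2 ∂configMeasure SU2 L := by
  haveI : SecondCountableTopology SU2 := secondCountableTopology_su2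
  have h1 : ∫ p, Ω p.1 * transferKernel su2Rep β p.1 p.2 * Ω p.2 * J p.2 ∂(configMeasure SU2 L).prod (configMeasure SU2 L) =
      ∫ p, Ω p.1 * transferKernel su2Rep β p.1 p.2 * (J p.2 * Ω p.2) ∂(configMeasure SU2 L).prod (configMeasure SU2 L) :=
    integral_congr_ae (ae_of_all _ fun p => by ring)
  rw [h1, ← qform_eq_integral_prod su2Rep continuous_su2Rep β hΩ hJΩ, qform_su2Rep_comm β hΩ hJΩ, qform_eq_l2_transferApply, heig,
    l2_comm, l2_smul_left, l2_comm]
  unfold l2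
  congr 1
  exact integral_congr_ae (ae_of_all _ fun U => by ring)

/-! ## §3 The magnetic energy of a non-negative vacuum -/

/-- ★★ **Vacuum magnetic energy, non-negative representative.**  `β ≥ 1`; `Ω ≥ 0` physical, `‖Ω‖ = 1`, `K_βΩ = λ₀Ω`.  Then
`∫ S(U) Ω(U)² dU ≤ (−log uniformFloorConst L)/β`: tangent-line Jensen on the vacuum pair measure with the full magnetic tilt
`X = (β/2)(S(U)+S(V))` (`e^X K_β = E_β`, row sums `c_β^{|E|}`), against the β-uniform floor `uniformFloorConst L · c_β^{|E|} ≤ λ₀`.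
[cite: Luscher1983, §2–3] [cite: ReedSimonIV1978, Thm. XIII.1] -/
theorem vacuum_magnetic_energy_le_of_nonneg {β : ℝ} (hβ : 1 ≤ β) {Ω : GaugeConfig 3 L SU2 → ℝ} (hΩ : IsPhys Ω)
    (hΩnn : ∀ U, 0 ≤ Ω U) (hn : l2 Ω Ω = 1) (heig : transferApply β Ω = topValue su2Rep L β • Ω) :
    ∫ U, wilsonAction su2Rep U * Ω U ^ 2 ∂configMeasure SU2 L ≤ -Real.log (uniformFloorConst L) / β := by
  haveI : SecondCountableTopology SU2 := secondCountableTopology_su2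
  have hβ0 : 0 < β := by linarith
  set μ2 : Measure (GaugeConfig 3 L SU2 × GaugeConfig 3 L SU2) := (configMeasure SU2 L).prod (configMeasure SU2 L) with hμ2
  set E : ℕ := Fintype.card (Edge 3 L) with hE
  set P : ℕ := Fintype.card (Plaquette 3 L) with hP
  set T : ℝ := topValue su2Rep L β with hT_def
  have hT : 0 < T := topValue_su2Rep_pos L β
  obtain ⟨CΩ, hCΩ⟩ := hΩ.bounded
  have hCΩ0 : 0 ≤ CΩ := (abs_nonneg _).trans (hCΩ (fun _ => 1))
  -- the pair weight and the magnetic tilt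
  set w : GaugeConfig 3 L SU2 × GaugeConfig 3 L SU2 → ℝ := fun p => Ω p.1 * transferKernel su2Rep β p.1 p.2 * Ω p.2 with hw_def
  set X : GaugeConfig 3 L SU2 × GaugeConfig 3 L SU2 → ℝ :=
    fun p => β / 2 * (wilsonAction su2Rep p.1 + wilsonAction su2Rep p.2) with hX_def
  have hw0 : ∀ p, 0 ≤ w p := fun p =>
    mul_nonneg (mul_nonneg (hΩnn _) (transferKernel_pos _ _ _ _).le) (hΩnn _)
  have hS0 : ∀ U : GaugeConfig 3 L SU2, 0 ≤ wilsonAction su2Rep U := wilsonAction_su2_nonneg_lat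
  have hS4 : ∀ U : GaugeConfig 3 L SU2, wilsonAction su2Rep U ≤ 4 * P := fun U => by
    rw [hP]; exact wilsonAction_su2_le_four_card_lat U
  have hX0 : ∀ p, 0 ≤ X p := fun p => by
    rw [hX_def]; dsimp only; exact mul_nonneg (by positivity) (add_nonneg (hS0 _) (hS0 _))
  have hXle : ∀ p, X p ≤ 4 * β * P := fun p => by
    rw [hX_def]; dsimp only; nlinarith [hS4 p.1, hS4 p.2, hS0 p.1, hS0 p.2]
  -- measurability / integrability
  have hKm : Measurable fun p : GaugeConfig 3 L SU2 × GaugeConfig 3 L SU2 => transferKernel su2Rep β p.1 p.2 :=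
    measurable_transferKernel_lat β
  have hSm : Measurable fun U : GaugeConfig 3 L SU2 => wilsonAction su2Rep U := FemtoCutoffLadder.measurable_wilsonAction_su2Lat
  have hwm : Measurable w := ((hΩ.measurable.comp measurable_fst).mul hKm).mul (hΩ.measurable.comp measurable_snd)
  have hXm : Measurable X := measurable_const.mul ((hSm.comp measurable_fst).add (hSm.comp measurable_snd))
  have hKb : ∀ p : GaugeConfig 3 L SU2 × GaugeConfig 3 L SU2, |transferKernel su2Rep β p.1 p.2| ≤ Real.exp (2 * β) ^ E :=
    fun p => abs_transferKernel_le_lat hβ0.le p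
  have hwb : ∀ p, |w p| ≤ CΩ * Real.exp (2 * β) ^ E * CΩ := fun p => by
    rw [hw_def]; dsimp only; rw [abs_mul, abs_mul]
    exact mul_le_mul (mul_le_mul (hCΩ _) (hKb p) (abs_nonneg _) hCΩ0) (hCΩ _) (abs_nonneg _) (by positivity)
  have hXb : ∀ p, |X p| ≤ 4 * β * P := fun p => by rw [abs_of_nonneg (hX0 p)]; exact hXle p
  have hwi : Integrable w μ2 := integrable_latProd hwm hwb
  have hXwi : Integrable (fun p => X p * w p) μ2 :=
    integrable_latProd (hXm.mul hwm) (C := 4 * β * P * (CΩ * Real.exp (2 * β) ^ E * CΩ)) fun p => by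
      rw [abs_mul]; exact mul_le_mul (hXb p) (hwb p) (abs_nonneg _) (by positivity)
  have heXwi : Integrable (fun p => Real.exp (X p) * w p) μ2 :=
    integrable_latProd ((Real.measurable_exp.comp hXm).mul hwm)
      (C := Real.exp (4 * β * P) * (CΩ * Real.exp (2 * β) ^ E * CΩ)) fun p => by
      rw [abs_mul, abs_of_pos (Real.exp_pos _)]
      exact mul_le_mul (Real.exp_le_exp.2 (hXle p)) (hwb p) (abs_nonneg _) (Real.exp_pos _).le
  -- total mass `∫ w = λ₀`
  have hwT : ∫ p, w p ∂μ2 = T := by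
    rw [hw_def, hμ2, ← qform_eq_integral_latProd hβ0.le hΩ, qform_eq_l2_transferApply, heig, l2_comm, l2_smul_left, hn, mul_one]
  -- the tilted mass: `e^X K_β = E_β`, so `M = ∫∫ Ω E_β Ω ≤ c_β^{|E|}`
  set M : ℝ := ∫ p, Real.exp (X p) * w p ∂μ2 with hM_def
  have hΩ2int : ∫ U, Ω U ^ 2 ∂configMeasure SU2 L = 1 := by
    rw [← hn]; unfold l2; exact integral_congr_ae (ae_of_all _ fun U => by ring)
  have hMle : M ≤ latCE L β := by
    have hpt : ∀ p, Real.exp (X p) * w p ≤ latE L β p.1 p.2 * (Ω p.1 ^ 2) / 2 + latE L β p.1 p.2 * (Ω p.2 ^ 2) / 2 := by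
      intro p
      have hexp : Real.exp (X p) * transferKernel su2Rep β p.1 p.2 = latE L β p.1 p.2 := by
        rw [transferKernel_eq_latE_mul, hX_def]; dsimp only
        rw [mul_comm, mul_assoc, ← Real.exp_add]
        have : -(β / 2) * (wilsonAction su2Rep p.1 + wilsonAction su2Rep p.2) +
            β / 2 * (wilsonAction su2Rep p.1 + wilsonAction su2Rep p.2) = 0 := by ring
        rw [this, Real.exp_zero, mul_one]
      have h2 : Real.exp (X p) * w p = (Real.exp (X p) * transferKernel su2Rep β p.1 p.2) * (Ω p.1 * Ω p.2) := by
        rw [hw_def]; ring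
      rw [h2, hexp]
      have hamgm : Ω p.1 * Ω p.2 ≤ (Ω p.1 ^ 2 + Ω p.2 ^ 2) / 2 := by nlinarith [sq_nonneg (Ω p.1 - Ω p.2)]
      have hE0 : 0 ≤ latE L β p.1 p.2 := (latE_pos _ _ _).le
      calc latE L β p.1 p.2 * (Ω p.1 * Ω p.2) ≤ latE L β p.1 p.2 * ((Ω p.1 ^ 2 + Ω p.2 ^ 2) / 2) :=
            mul_le_mul_of_nonneg_left hamgm hE0
        _ = latE L β p.1 p.2 * (Ω p.1 ^ 2) / 2 + latE L β p.1 p.2 * (Ω p.2 ^ 2) / 2 := by ring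
    have hfst := integral_prod_latE_mul_fst (L := L) β (hΩ.measurable.pow_const 2) (C := CΩ * CΩ)
      (fun U => by rw [abs_pow, sq]; exact mul_le_mul (hCΩ U) (hCΩ U) (abs_nonneg _) hCΩ0) hβ0.le
    have hsnd := integral_prod_latE_mul_snd (L := L) β (hΩ.measurable.pow_const 2) (C := CΩ * CΩ)
      (fun U => by rw [abs_pow, sq]; exact mul_le_mul (hCΩ U) (hCΩ U) (abs_nonneg _) hCΩ0) hβ0.le
    have hi1 : Integrable (fun p : GaugeConfig 3 L SU2 × GaugeConfig 3 L SU2 => latE L β p.1 p.2 * Ω p.1 ^ 2) μ2 :=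
      integrable_latProd ((measurable_latE β).mul ((hΩ.measurable.pow_const 2).comp measurable_fst))
        (C := Real.exp (2 * β) ^ E * (CΩ * CΩ)) fun p => by
        rw [abs_mul]
        exact mul_le_mul (abs_latE_le hβ0.le _ _)
          (by rw [abs_pow, sq]; exact mul_le_mul (hCΩ _) (hCΩ _) (abs_nonneg _) hCΩ0) (abs_nonneg _) (by positivity)
    have hi2 : Integrable (fun p : GaugeConfig 3 L SU2 × GaugeConfig 3 L SU2 => latE L β p.1 p.2 * Ω p.2 ^ 2) μ2 :=
      integrable_latProd ((measurable_latE β).mul ((hΩ.measurable.pow_const 2).comp measurable_snd))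
        (C := Real.exp (2 * β) ^ E * (CΩ * CΩ)) fun p => by
        rw [abs_mul]
        exact mul_le_mul (abs_latE_le hβ0.le _ _)
          (by rw [abs_pow, sq]; exact mul_le_mul (hCΩ _) (hCΩ _) (abs_nonneg _) hCΩ0) (abs_nonneg _) (by positivity)
    have hrhs_int : Integrable (fun p : GaugeConfig 3 L SU2 × GaugeConfig 3 L SU2 =>
        latE L β p.1 p.2 * (Ω p.1 ^ 2) / 2 + latE L β p.1 p.2 * (Ω p.2 ^ 2) / 2) μ2 :=
      (hi1.div_const 2).add (hi2.div_const 2)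
    have hmono := integral_mono heXwi hrhs_int hpt
    have hrhs : ∫ p, (latE L β p.1 p.2 * (Ω p.1 ^ 2) / 2 + latE L β p.1 p.2 * (Ω p.2 ^ 2) / 2) ∂μ2 = latCE L β := by
      rw [integral_add (hi1.div_const 2) (hi2.div_const 2), integral_div, integral_div, hμ2, hfst, hsnd, hΩ2int]
      ring
    rw [hrhs] at hmono
    exact hmono
  have hMpos : 0 < M := by
    have hge : ∫ p, w p ∂μ2 ≤ M := integral_mono hwi heXwi fun p => by
      have : 1 ≤ Real.exp (X p) := Real.one_le_exp (hX0 p)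
      nlinarith [hw0 p]
    linarith
  -- Jensen
  have hJ := integral_mul_le_mul_log μ2 hw0 hT hwT hXwi heXwi hwi rfl hMpos
  -- the β-uniform floor turns `log(M/λ₀)` into `−log c_L`
  have hu : 0 < uniformFloorConst L := uniformFloorConst_pos
  have hfloor : uniformFloorConst L * latCE L β ≤ T := by
    have h := levelValue_zero_ge_uniform (L := L) hβ
    rw [levelValue_zero] at h
    exact h
  have hlog : Real.log (M / T) ≤ -Real.log (uniformFloorConst L) := by
    have h1 : M / T ≤ (uniformFloorConst L)⁻¹ := by
      rw [div_le_iff₀ hT]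
      calc M ≤ latCE L β := hMle
        _ = (uniformFloorConst L)⁻¹ * (uniformFloorConst L * latCE L β) := by field_simp
        _ ≤ (uniformFloorConst L)⁻¹ * T := mul_le_mul_of_nonneg_left hfloor (inv_nonneg.2 hu.le)
    calc Real.log (M / T) ≤ Real.log ((uniformFloorConst L)⁻¹) := Real.log_le_log (div_pos hMpos hT) h1
      _ = -Real.log (uniformFloorConst L) := Real.log_inv _
  -- the left side: `∫ X w = β λ₀ ∫ S Ω²`
  have hSΩ : IsPhys fun U => wilsonAction su2Rep U * Ω U := isPhys_wilsonAction_mul hΩ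
  have hfstS := integral_pair_mul_fst_eq (L := L) β hSΩ hΩ heig
  have hsndS := integral_pair_mul_snd_eq (L := L) β hSΩ hΩ heig
  have hiS1 : Integrable (fun p : GaugeConfig 3 L SU2 × GaugeConfig 3 L SU2 =>
      Ω p.1 * transferKernel su2Rep β p.1 p.2 * Ω p.2 * wilsonAction su2Rep p.1) μ2 :=
    integrable_latProd (hwm.mul (hSm.comp measurable_fst)) (C := CΩ * Real.exp (2 * β) ^ E * CΩ * (4 * P)) fun p => by
      rw [abs_mul]; exact mul_le_mul (hwb p) (by rw [abs_of_nonneg (hS0 _)]; exact hS4 _) (abs_nonneg _) (by positivity)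
  have hiS2 : Integrable (fun p : GaugeConfig 3 L SU2 × GaugeConfig 3 L SU2 =>
      Ω p.1 * transferKernel su2Rep β p.1 p.2 * Ω p.2 * wilsonAction su2Rep p.2) μ2 :=
    integrable_latProd (hwm.mul (hSm.comp measurable_snd)) (C := CΩ * Real.exp (2 * β) ^ E * CΩ * (4 * P)) fun p => by
      rw [abs_mul]; exact mul_le_mul (hwb p) (by rw [abs_of_nonneg (hS0 _)]; exact hS4 _) (abs_nonneg _) (by positivity)
  have hXw : ∫ p, X p * w p ∂μ2 = β * T * ∫ U, wilsonAction su2Rep U * Ω U ^ 2 ∂configMeasure SU2 L := by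
    have hsplit : (fun p => X p * w p) = fun p =>
        β / 2 * (Ω p.1 * transferKernel su2Rep β p.1 p.2 * Ω p.2 * wilsonAction su2Rep p.1) +
          β / 2 * (Ω p.1 * transferKernel su2Rep β p.1 p.2 * Ω p.2 * wilsonAction su2Rep p.2) := by
      funext p; rw [hX_def, hw_def]; ring
    rw [hsplit, integral_add (hiS1.const_mul _) (hiS2.const_mul _), integral_const_mul, integral_const_mul, hμ2, hfstS, hsndS,
      ← hT_def]
    ring
  -- assemble
  rw [hXw] at hJ
  have hfin : β * T * ∫ U, wilsonAction su2Rep U * Ω U ^ 2 ∂configMeasure SU2 L ≤ T * (-Real.log (uniformFloorConst L)) :=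
    hJ.trans (mul_le_mul_of_nonneg_left hlog hT.le)
  rw [le_div_iff₀ hβ0]
  have : β * T * ∫ U, wilsonAction su2Rep U * Ω U ^ 2 ∂configMeasure SU2 L =
      T * ((∫ U, wilsonAction su2Rep U * Ω U ^ 2 ∂configMeasure SU2 L) * β) := by ring
  rw [this] at hfin
  exact le_of_mul_le_mul_left hfin hT

/-! ## §4 Every normalised physical eigenfunction at `λ₀` (Perron–Frobenius) -/

/-- ★★ **VACUUM MAGNETIC ENERGY** (`β ≥ 1`, every `L`): for every `l2`-normalised physical `Ω` with `K_βΩ = λ₀Ω`,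
`∫ S(U) Ω(U)² dU ≤ (−log uniformFloorConst L)/β` — the expected spatial Wilson action of the exact zero-flux ground state of `SU(2)` on
`(ℤ/L)³` is `O(L³ log L/β)`, i.e. `O(log L/β)` per plaquette, uniformly in `β ≥ 1`.  (By Perron–Frobenius–Jentzsch `Ω = ±|c|Ω₊` a.e. with
`Ω₊ > 0` the normalised ground state, and `∫SΩ²` is even in `Ω`.) [cite: ReedSimonIV1978, Thm. XIII.43] [cite: Luscher1983, §2–3] -/
theorem vacuum_magnetic_energy_le {β : ℝ} (hβ : 1 ≤ β) {Ω : GaugeConfig 3 L SU2 → ℝ} (hΩ : IsPhys Ω)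
    (hn : l2 Ω Ω = 1) (heig : transferApply β Ω = topValue su2Rep L β • Ω) :
    ∫ U, wilsonAction su2Rep U * Ω U ^ 2 ∂configMeasure SU2 L ≤ -Real.log (uniformFloorConst L) / β := by
  -- the positive ground state and the a.e. identification `Ω = c Ω₊`
  obtain ⟨Ωp, θ, cp, hΩp, hcp, hΩpge, hnp, heigp, -, hθ, hgap⟩ := PhysL2.exists_groundState (L := L) β
  set c : ℝ := l2 Ω Ωp with hc
  have hae : Ω =ᵐ[configMeasure SU2 L] fun U => c * Ωp U := ae_eq_smul_groundState hΩ hΩp hnp heig heigp hθ hgap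
  set Ω'' : GaugeConfig 3 L SU2 → ℝ := fun U => |c| * Ωp U with hΩ''_def
  have hΩ'' : IsPhys Ω'' := by
    have h := hΩp.smul |c|
    have e : (|c| • Ωp) = Ω'' := by funext U; simp [hΩ''_def]
    rw [← e]; exact h
  have hΩ''nn : ∀ U, 0 ≤ Ω'' U := fun U => mul_nonneg (abs_nonneg c) (hcp.le.trans (hΩpge U))
  have heig'' : transferApply β Ω'' = topValue su2Rep L β • Ω'' := by
    have e : Ω'' = |c| • Ωp := by funext U; simp [hΩ''_def]
    rw [e, transferApply_smul, heigp, smul_smul, smul_smul, mul_comm]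
  -- squares agree a.e.
  have hsq : (fun U => Ω U ^ 2) =ᵐ[configMeasure SU2 L] fun U => Ω'' U ^ 2 := by
    filter_upwards [hae] with U hU
    rw [hU, hΩ''_def]; dsimp only; rw [mul_pow, mul_pow, sq_abs]
  have hn'' : l2 Ω'' Ω'' = 1 := by
    rw [← hn]; unfold l2
    refine integral_congr_ae ?_
    filter_upwards [hsq] with U hU
    have h1 : Ω'' U * Ω'' U = Ω'' U ^ 2 := by ring
    have h2 : Ω U * Ω U = Ω U ^ 2 := by ring
    rw [h1, h2, hU]
  have hint : ∫ U, wilsonAction su2Rep U * Ω U ^ 2 ∂configMeasure SU2 L = ∫ U, wilsonAction su2Rep U * Ω'' U ^ 2 ∂configMeasure SU2 L := by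
    refine integral_congr_ae ?_
    filter_upwards [hsq] with U hU
    rw [hU]
  rw [hint]
  exact vacuum_magnetic_energy_le_of_nonneg hβ hΩ'' hΩ''nn hn'' heig''

/-- ★ **Each plaquette** of the exact vacuum: `∫ (2 − Re tr U_p) Ω(U)² dU ≤ (−log uniformFloorConst L)/β` (`β ≥ 1`; a single term of the
non-negative sum `S`). [cite: Luscher1983, §2–3] -/
theorem vacuum_plaquette_le {β : ℝ} (hβ : 1 ≤ β) {Ω : GaugeConfig 3 L SU2 → ℝ} (hΩ : IsPhys Ω)
    (hn : l2 Ω Ω = 1) (heig : transferApply β Ω = topValue su2Rep L β • Ω) (p : Plaquette 3 L) :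
    ∫ U, (2 - ((su2Rep (plaquetteHolonomy U p.1 p.2.1.1 p.2.1.2)).trace).re) * Ω U ^ 2 ∂configMeasure SU2 L ≤
      -Real.log (uniformFloorConst L) / β := by
  haveI : SecondCountableTopology SU2 := secondCountableTopology_su2
  refine le_trans ?_ (vacuum_magnetic_energy_le hβ hΩ hn heig)
  obtain ⟨CΩ, hCΩ⟩ := hΩ.bounded
  have hCΩ0 : 0 ≤ CΩ := (abs_nonneg _).trans (hCΩ (fun _ => 1))
  have hΩ2b : ∀ U, |Ω U ^ 2| ≤ CΩ * CΩ := fun U => by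
    rw [abs_pow, sq]; exact mul_le_mul (hCΩ U) (hCΩ U) (abs_nonneg _) hCΩ0
  -- the single plaquette term is continuous, bounded, between `0` and `4`
  have hterm_nn : ∀ (U : GaugeConfig 3 L SU2) (q : Plaquette 3 L),
      0 ≤ 2 - ((su2Rep (plaquetteHolonomy U q.1 q.2.1.1 q.2.1.2)).trace).re := fun U q => by
    have h := re_trace_le_two (plaquetteHolonomy U q.1 q.2.1.1 q.2.1.2)
    rw [fundamentalRep_apply]; linarith
  have hterm_le : ∀ (U : GaugeConfig 3 L SU2) (q : Plaquette 3 L),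
      2 - ((su2Rep (plaquetteHolonomy U q.1 q.2.1.1 q.2.1.2)).trace).re ≤ 4 := fun U q => by
    have h := neg_two_le_re_trace (plaquetteHolonomy U q.1 q.2.1.1 q.2.1.2)
    rw [fundamentalRep_apply]; linarith
  have hterm_m : ∀ q : Plaquette 3 L, Measurable fun U : GaugeConfig 3 L SU2 =>
      2 - ((su2Rep (plaquetteHolonomy U q.1 q.2.1.1 q.2.1.2)).trace).re := fun q => by
    have h1 : Continuous fun U : GaugeConfig 3 L SU2 => plaquetteHolonomy U q.1 q.2.1.1 q.2.1.2 := by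
      unfold plaquetteHolonomy; fun_prop
    exact (continuous_const.sub (Complex.continuous_re.comp (continuous_su2Rep.comp h1).matrix_trace)).measurable
  have hint : ∀ q : Plaquette 3 L, Integrable (fun U : GaugeConfig 3 L SU2 =>
      (2 - ((su2Rep (plaquetteHolonomy U q.1 q.2.1.1 q.2.1.2)).trace).re) * Ω U ^ 2) (configMeasure SU2 L) := fun q =>
    integrable_of_measurable_abs_le _ ((hterm_m q).mul (hΩ.measurable.pow_const 2)) (C := 4 * (CΩ * CΩ)) fun U => by
      rw [abs_mul, abs_of_nonneg (hterm_nn U q)]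
      exact mul_le_mul (hterm_le U q) (hΩ2b U) (abs_nonneg _) (by norm_num)
  -- `S Ω² = Σ_q term_q Ω²`
  have hsum : (fun U : GaugeConfig 3 L SU2 => wilsonAction su2Rep U * Ω U ^ 2) =
      fun U => ∑ q : Plaquette 3 L, (2 - ((su2Rep (plaquetteHolonomy U q.1 q.2.1.1 q.2.1.2)).trace).re) * Ω U ^ 2 := by
    funext U
    unfold wilsonAction
    rw [Finset.sum_mul]
    push_cast
    rfl
  rw [hsum, integral_finsetSum _ fun q _ => hint q]
  have hnn : ∀ q ∈ (Finset.univ : Finset (Plaquette 3 L)), (0 : ℝ) ≤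
      ∫ U, (2 - ((su2Rep (plaquetteHolonomy U q.1 q.2.1.1 q.2.1.2)).trace).re) * Ω U ^ 2 ∂configMeasure SU2 L :=
    fun q _ => integral_nonneg fun U => mul_nonneg (hterm_nn U q) (sq_nonneg _)
  exact Finset.single_le_sum hnn (Finset.mem_univ p)

end Summit.QuantumFields.YangMills.Theorems.TransportFieldFano

end
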